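import Literature.NumberTheory.GaloisRepresentations.ContinuousH1
import Literature.AnabelianGeometry.AbsoluteAnabelian.FreeProlRankLinearProofs
import Literature.AnabelianGeometry.AbsoluteAnabelian.AbsTopIThm26iii
import HarnessLib

/-!
# [AbsTopI] Thm 2.6: `δ¹_l(H) = dim_{ℚ_l} H¹(H, ℚ_l)` IS the free pro-`l` rank, for compact `H`

S. Mochizuki, *Topics in Absolute Anabelian Geometry I: Generalities* (2012) [AbsTopI], Thm 2.6,
manuscript p. 21 (lit key `paper:url-11ac98ba15fc`): "If `H` is a profinite group, `j ∈ {1, 2}`, and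
`l ∈ Primes`, write `δʲ_l(H) := dim_{ℚ_l}(Hʲ(H, ℚ_l)) ∈ ℕ ∪ {∞}`, `εʲ_l(Π) := sup_{J ⊆ Π} {δʲ_l(J)}`,
`θʲ(Π) := {l | εʲ_l(Π) ≥ 3 − j}` [where `J` ranges over the open subgroups of `Π`]" and (ii) "…
Finally, `ε¹_p(Π) = ∞`; in particular, the cardinality of `θ¹(Π)` is always `≥ 1`."

PROOF-ONLY companion (no definitions, no named facts).  The tree carries TWO typings of the
printed invariant `δ¹_l`:
* abc-iut-L4-t4's `freeProlRank H l` (`ProfiniteTerminology.lean`): the supremum of the `n` with a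
  continuous surjection `H ↠ ℤ_lⁿ` — the vocabulary of the typed [AbsTopI] Thm 2.6 (i)(ii)(v)(vi)
  and of [AbsAnab] Lemma 1.1.4 (ii); its docstring records the identification with
  `dim_{ℚ_l} H¹(H, ℚ_l)` "but do[es] not prove" it;
* abc-iut-L4-t4's print-literal `deltaInv H 1 l` (`AbsTopIThm26iii.lean`): the `ℚ_l`-dimension (in
  `ℕ∞`) of Mathlib's continuous cohomology `continuousCohomology 1` of the trivial topological
  representation on `ℚ_l` — the vocabulary of the typed Thm 2.6 (iii) (`epsilonInv`, `thetaSet`).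

THIS FILE PROVES THE IDENTIFICATION for every COMPACT topological group (no finite generation is
needed): `deltaInv_one_eq_freeProlRank : deltaInv H 1 l = freeProlRank H l`.  Route:
(a) `H¹_cont(H, ℚ_l) ≅ Z¹_cont(H, ℚ_l)` = the continuous additive characters `H → ℚ_l` — the class
    map `oneCocycleClassₗ` of the tree's `Literature/NumberTheory/GaloisRepresentations/ContinuousH1`
    (continuous `H¹` = continuous crossed homomorphisms modulo principal ones, Serre I.§2.2/§5.1) is
    surjective, and injective because principal crossed homomorphisms of a TRIVIAL representation
    vanish (`rank_continuousCohomology_one_trivial`);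
(b) compactness: a continuous character `H → ℚ_l` is bounded, hence `l^{-k}ℤ_l`-valued, and `l^k`
    times it is a continuous homomorphism `H → ℤ_l` with the same `ℚ_l`-span;
(c) the dictionary of `FreeProlRankLinearProofs.lean` (abc-iut-L4 lineage): `n ≤ freeProlRank H l`
    iff there are `n` continuous homomorphisms `H → ℤ_l` linearly independent over `ℚ_l` as
    `ℚ_l`-valued functions (compact case);
so the two `ℕ∞`-valued invariants have the same set of natural lower bounds.
Corollaries: `epsilonInv_one_eq_iSup_freeProlRank` (ε¹_l(Π) in `freeProlRank` terms) and
`FundamentalExtension.residueChar_mem_thetaSet_one_of_thm26ii` — the printed "in particular, the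
cardinality of `θ¹(Π)` is always `≥ 1`" of Thm 2.6 (ii): the typed `Thm26ii` gives `p ∈ θ¹(Π)`.
HONEST FRAMING: classical profinite group theory / continuous cohomology bookkeeping from a refereed
paper; nothing here bears on [IUTchIII] Cor. 3.12.
-/

noncomputable section

open Topology

namespace Literature.AnabelianGeometry.AbsoluteAnabelian

open Literature.NumberTheory.GaloisRepresentations

universe u

variable {G : Type u} [Group G] [TopologicalSpace G]

/-! ### (a) `H¹_cont(G, ℚ_l) ≅ Z¹_cont(G, ℚ_l)` for the trivial action -/

/-- For the trivial topological representation of `G` on `ℚ_l` the class map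
`Z¹_cont(G, ℚ_l) → H¹_cont(G, ℚ_l)` of the tree's `ContinuousH1` is bijective (a principal crossed
homomorphism `g ↦ g • v − v` of a trivial representation is zero), so `H¹_cont(G, ℚ_l)` and the
module of continuous additive characters `G → ℚ_l` have the same `ℚ_l`-rank.
[cite: MochizukiAbsTopI2012, Thm 2.6 p.21] -/
theorem rank_continuousCohomology_one_trivial [IsTopologicalGroup G] (l : ℕ) [Fact l.Prime] :
    Module.rank ℚ_[l] (continuousCohomology 1
        (TopRep.of (ContRepresentation.trivial ℚ_[l] G (ULift.{u} ℚ_[l])))) =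
      Module.rank ℚ_[l] (contOneCocycles
        (TopRep.of (ContRepresentation.trivial ℚ_[l] G (ULift.{u} ℚ_[l])))) := by
  have hinj : Function.Injective
      (oneCocycleClassₗ (TopRep.of (ContRepresentation.trivial ℚ_[l] G (ULift.{u} ℚ_[l])))) := by
    rw [injective_iff_map_eq_zero]
    intro φ hφ
    rw [oneCocycleClassₗ_apply, oneCocycleClass_eq_zero_iff] at hφ
    obtain ⟨v, hv⟩ := hφ
    refine Subtype.ext (ContinuousMap.ext fun g => ?_)
    rw [hv g, TopRep.of_ρ, ContRepresentation.trivial_apply, sub_self]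
    rfl
  have hsurj : Function.Surjective
      (oneCocycleClassₗ (TopRep.of (ContRepresentation.trivial ℚ_[l] G (ULift.{u} ℚ_[l])))) :=
    fun γ => oneCocycleClass_surjective _ γ
  exact (LinearEquiv.ofBijective _ ⟨hinj, hsurj⟩).rank_eq.symm

/-! ### (b) Continuous characters: `Z¹_cont(G, ℚ_l)` versus `ℚ_l`-valued functions on `G` -/

/-- A family of continuous `1`-cocycles of the trivial representation on `ℚ_l` is linearly
independent iff the family of underlying `ℚ_l`-valued functions on `G` is (the forgetful map
`C(G, ULift ℚ_l) → (G → ℚ_l)` is an injective `ℚ_l`-linear map). [folklore] -/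
private theorem linearIndependent_contOneCocycles_iff (l : ℕ) [Fact l.Prime] {ι : Type*}
    (ψ : ι → contOneCocycles (TopRep.of (ContRepresentation.trivial ℚ_[l] G (ULift.{u} ℚ_[l])))) :
    LinearIndependent ℚ_[l] ψ ↔
      LinearIndependent ℚ_[l] (fun i (g : G) => ((ψ i).1 g).down) := by
  -- the forgetful map `C(G, ULift ℚ_l) → (G → ℚ_l)`, an injective linear map
  let D : C(G, ULift.{u} ℚ_[l]) →ₗ[ℚ_[l]] (G → ℚ_[l]) :=
    { toFun := fun F g => (F g).down
      map_add' := fun F F' => funext fun g => by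
        simp only [ContinuousMap.add_apply, ULift.add_down, Pi.add_apply]
      map_smul' := fun c F => funext fun g => by
        simp only [ContinuousMap.smul_apply, ULift.smul_down, RingHom.id_apply, Pi.smul_apply] }
  have hDapp : ∀ (F : C(G, ULift.{u} ℚ_[l])) (g : G), D F g = (F g).down := fun F g => rfl
  have hD : LinearMap.ker D = ⊥ := by
    refine LinearMap.ker_eq_bot.mpr fun F F' h => ContinuousMap.ext fun g => ULift.ext _ _ ?_
    rw [← hDapp F g, ← hDapp F' g, h]
  have hker : LinearMap.ker (D ∘ₗ (contOneCocycles
      (TopRep.of (ContRepresentation.trivial ℚ_[l] G (ULift.{u} ℚ_[l])))).subtype) = ⊥ := by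
    rw [LinearMap.ker_comp, hD, Submodule.comap_bot, Submodule.ker_subtype]
  have key := LinearMap.linearIndependent_iff (v := ψ) _ hker
  have hcomp : (⇑(D ∘ₗ (contOneCocycles
      (TopRep.of (ContRepresentation.trivial ℚ_[l] G (ULift.{u} ℚ_[l])))).subtype) ∘ ψ) =
      fun i (g : G) => ((ψ i).1 g).down := by
    funext i g
    rw [Function.comp_apply, LinearMap.comp_apply, Submodule.subtype_apply, hDapp]
  rw [hcomp] at key
  exact key.symm

/-- **From a surjection onto `ℤ_lⁿ` to `n` independent classes**: if `n ≤ freeProlRank G l` then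
the trivial representation on `ℚ_l` has `n` linearly independent continuous `1`-cocycles (the
coordinate characters `G ↠ ℤ_lⁿ → ℤ_l ⊆ ℚ_l`).  No compactness is needed in this direction.
[cite: MochizukiAbsTopI2012, Thm 2.6 p.21] -/
theorem exists_linearIndependent_contOneCocycles_of_le_freeProlRank (l : ℕ) [Fact l.Prime]
    {n : ℕ} (hn : (n : ℕ∞) ≤ freeProlRank G l) :
    ∃ ψ : Fin n →
        contOneCocycles (TopRep.of (ContRepresentation.trivial ℚ_[l] G (ULift.{u} ℚ_[l]))),
      LinearIndependent ℚ_[l] ψ := by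
  obtain ⟨φ, hφ⟩ := exists_linearIndependent_of_le_freeProlRank (H := G) l hn
  -- the coordinate characters as continuous `1`-cocycles of the trivial representation
  let ψ : Fin n →
      contOneCocycles (TopRep.of (ContRepresentation.trivial ℚ_[l] G (ULift.{u} ℚ_[l]))) :=
    fun i =>
      ⟨⟨fun g => ULift.up (((Multiplicative.toAdd (φ i g) : ℤ_[l]) : ℚ_[l])),
          continuous_uliftUp.comp
            (continuous_subtype_val.comp (continuous_toAdd.comp (φ i).continuous))⟩,
        fun g h => by
          rw [TopRep.of_ρ, ContRepresentation.trivial_apply]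
          apply ULift.ext
          simp only [ContinuousMap.coe_mk, map_mul, toAdd_mul, PadicInt.coe_add, ULift.add_down]⟩
  refine ⟨ψ, ?_⟩
  rw [linearIndependent_contOneCocycles_iff]
  exact hφ

omit [Group G] in
/-- A continuous `ℚ_l`-valued function on a compact space is `l^{-k}ℤ_l`-valued for some `k`:
multiplying by `l^k` lands in `ℤ_l = {‖·‖ ≤ 1}`. [folklore] -/
private theorem exists_pow_mul_norm_le_one_of_compactSpace [CompactSpace G] (l : ℕ) [Fact l.Prime]
    (f : G → ℚ_[l]) (hf : Continuous f) :
    ∃ k : ℕ, ∀ g : G, ‖(l : ℚ_[l]) ^ k * f g‖ ≤ 1 := by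
  obtain ⟨R, hR⟩ := (isCompact_range hf).isBounded.exists_norm_le
  have hl : (1 : ℝ) < l := by exact_mod_cast (Fact.out : l.Prime).one_lt
  obtain ⟨k, hk⟩ := pow_unbounded_of_one_lt R hl
  refine ⟨k, fun g => ?_⟩
  have hfg : ‖f g‖ ≤ R := hR _ ⟨g, rfl⟩
  have hlpos : (0 : ℝ) < (l : ℝ) ^ k := pow_pos (by positivity) k
  rw [norm_mul, norm_pow, Padic.norm_p, inv_pow]
  calc ((l : ℝ) ^ k)⁻¹ * ‖f g‖ ≤ ((l : ℝ) ^ k)⁻¹ * (l : ℝ) ^ k := by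
        gcongr
        exact hfg.trans hk.le
    _ = 1 := inv_mul_cancel₀ hlpos.ne'

/-- **From `n` independent classes to a surjection onto `ℤ_lⁿ`** (compact `G`): `n` linearly
independent continuous `1`-cocycles of the trivial representation on `ℚ_l` — i.e. `n` continuous
additive characters `G → ℚ_l` independent over `ℚ_l` — give, after a common rescaling by a power of
`l` into `ℤ_l`, `n` independent continuous homomorphisms `G → ℤ_l`, hence (by
`le_freeProlRank_of_linearIndependent`) `n ≤ freeProlRank G l`. [cite: MochizukiAbsTopI2012, Thm 2.6 p.21] -/
theorem le_freeProlRank_of_linearIndependent_contOneCocycles [CompactSpace G] (l : ℕ)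
    [Fact l.Prime] {n : ℕ}
    (ψ : Fin n →
      contOneCocycles (TopRep.of (ContRepresentation.trivial ℚ_[l] G (ULift.{u} ℚ_[l]))))
    (hψ : LinearIndependent ℚ_[l] ψ) : (n : ℕ∞) ≤ freeProlRank G l := by
  classical
  rw [linearIndependent_contOneCocycles_iff] at hψ
  -- the underlying continuous characters `f i : G → ℚ_l`
  set f : Fin n → G → ℚ_[l] := fun i g => ((ψ i).1 g).down with hf
  have hfc : ∀ i, Continuous (f i) := fun i =>
    continuous_uliftDown.comp (ψ i).1.continuous
  have hfmul : ∀ i g h, f i (g * h) = f i g + f i h := fun i g h => by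
    have hc := (ψ i).2 g h
    rw [TopRep.of_ρ, ContRepresentation.trivial_apply] at hc
    simp only [hf, hc, ULift.add_down]
  -- a common power of `l` clearing all denominators
  have hk : ∀ i, ∃ k : ℕ, ∀ g : G, ‖(l : ℚ_[l]) ^ k * f i g‖ ≤ 1 := fun i =>
    exists_pow_mul_norm_le_one_of_compactSpace l (f i) (hfc i)
  choose k hk using hk
  let K : ℕ := Finset.univ.sup k
  have hK : ∀ i g, ‖(l : ℚ_[l]) ^ K * f i g‖ ≤ 1 := fun i g => by
    have hki : k i ≤ K := Finset.le_sup (Finset.mem_univ i)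
    have hsplit : (l : ℚ_[l]) ^ K * f i g = (l : ℚ_[l]) ^ (K - k i) * ((l : ℚ_[l]) ^ (k i) * f i g) := by
      rw [← mul_assoc, ← pow_add, Nat.sub_add_cancel hki]
    rw [hsplit, norm_mul, norm_pow, Padic.norm_p]
    have h1 : ((l : ℝ)⁻¹) ^ (K - k i) ≤ 1 := by
      apply pow_le_one₀ (by positivity)
      exact inv_le_one_of_one_le₀ (by exact_mod_cast (Fact.out : l.Prime).one_lt.le)
    calc ((l : ℝ)⁻¹) ^ (K - k i) * ‖(l : ℚ_[l]) ^ k i * f i g‖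
        ≤ 1 * 1 := by gcongr; exact hk i g
      _ = 1 := one_mul 1
  -- the rescaled characters `χ i : G → ℤ_l`
  let χ : Fin n → (G →ₜ* Multiplicative ℤ_[l]) := fun i =>
    { toFun := fun g => Multiplicative.ofAdd ⟨(l : ℚ_[l]) ^ K * f i g, hK i g⟩
      map_one' := by
        have h0 : f i 1 = 0 := by
          have := hfmul i 1 1
          rw [mul_one, left_eq_add] at this
          exact this
        rw [← ofAdd_zero]
        congr 1
        exact Subtype.ext (by simp [h0])
      map_mul' := fun a b => by
        rw [← ofAdd_add]
        congr 1
        exact Subtype.ext (by simp [hfmul, mul_add])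
      continuous_toFun := continuous_ofAdd.comp
        ((continuous_const.mul (hfc i)).subtype_mk _) }
  have hχ : ∀ i g, ((Multiplicative.toAdd (χ i g) : ℤ_[l]) : ℚ_[l]) = (l : ℚ_[l]) ^ K * f i g :=
    fun i g => rfl
  -- independence survives the common rescaling by the unit `l^K`
  have hunit : ((l : ℚ_[l]) ^ K) ≠ 0 :=
    pow_ne_zero K (by exact_mod_cast (Fact.out : l.Prime).ne_zero)
  have hli : LinearIndependent ℚ_[l]
      (fun (i : Fin n) (g : G) => ((Multiplicative.toAdd (χ i g) : ℤ_[l]) : ℚ_[l])) := by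
    have h := hψ.units_smul fun _ => Units.mk0 _ hunit
    convert h using 1
    funext i g
    rw [hχ, Pi.smul_apply', Pi.smul_apply, Units.smul_def, Units.val_mk0, smul_eq_mul]
  exact le_freeProlRank_of_linearIndependent l χ hli

/-- Unfolding the rank: `n ≤ dim_{ℚ_l} Z¹_cont(G, ℚ_l)` (as an element of `ℕ∞`) yields `n` linearly
independent continuous `1`-cocycles. [folklore] -/
private theorem exists_linearIndependent_contOneCocycles_of_le_toENat_rank (l : ℕ) [Fact l.Prime]
    {n : ℕ} (hn : (n : ℕ∞) ≤ Cardinal.toENat (Module.rank ℚ_[l]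
      (contOneCocycles (TopRep.of (ContRepresentation.trivial ℚ_[l] G (ULift.{u} ℚ_[l])))))) :
    ∃ ψ : Fin n →
        contOneCocycles (TopRep.of (ContRepresentation.trivial ℚ_[l] G (ULift.{u} ℚ_[l]))),
      LinearIndependent ℚ_[l] ψ := by
  letI : AddCommGroup
      (contOneCocycles (TopRep.of (ContRepresentation.trivial ℚ_[l] G (ULift.{u} ℚ_[l])))) :=
    Submodule.addCommGroup _
  haveI : Module.Free ℚ_[l]
      (contOneCocycles (TopRep.of (ContRepresentation.trivial ℚ_[l] G (ULift.{u} ℚ_[l])))) :=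
    Module.Free.of_divisionRing ℚ_[l] _
  rw [Cardinal.natCast_le_toENat, le_rank_iff_exists_linearIndependent_finset] at hn
  obtain ⟨s, hs, hli⟩ := hn
  exact ⟨_, hli.comp _ (Finset.equivFinOfCardEq hs).symm.injective⟩

/-! ### (c) The identification `δ¹_l = freeProlRank` and its corollaries -/

/-- **[AbsTopI] Thm 2.6: `δ¹_l(H) := dim_{ℚ_l} H¹(H, ℚ_l)` (continuous cohomology, the print-literal
`deltaInv H 1 l`) EQUALS the free pro-`l` rank `freeProlRank H l` (supremum of the `n` with
`H ↠ ℤ_lⁿ`) for every compact topological group `H`** — the identification recorded without proof in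
`ProfiniteTerminology.lean`; both `ℕ∞`-valued invariants have the same natural lower bounds by
(a), (b) and the dictionary of `FreeProlRankLinearProofs.lean`. [cite: MochizukiAbsTopI2012, Thm 2.6 p.21] -/
theorem deltaInv_one_eq_freeProlRank [IsTopologicalGroup G] [CompactSpace G] (l : ℕ)
    [Fact l.Prime] :
    deltaInv G 1 l = freeProlRank G l := by
  have hδ : deltaInv G 1 l = Cardinal.toENat (Module.rank ℚ_[l]
      (contOneCocycles (TopRep.of (ContRepresentation.trivial ℚ_[l] G (ULift.{u} ℚ_[l]))))) := by
    unfold deltaInv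
    rw [rank_continuousCohomology_one_trivial]
  rw [hδ]
  refine le_antisymm ?_ ?_
  · rw [← ENat.forall_natCast_le_iff_le]
    intro n hn
    obtain ⟨ψ, hψ⟩ := exists_linearIndependent_contOneCocycles_of_le_toENat_rank (G := G) l hn
    exact le_freeProlRank_of_linearIndependent_contOneCocycles l ψ hψ
  · rw [← ENat.forall_natCast_le_iff_le]
    intro n hn
    obtain ⟨ψ, hψ⟩ := exists_linearIndependent_contOneCocycles_of_le_freeProlRank (G := G) l hn
    rw [Cardinal.natCast_le_toENat]
    simpa using hψ.cardinal_lift_le_rank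

/-- An open subgroup of a compact group is compact (it is closed). [folklore] -/
private theorem compactSpace_subgroup_of_isOpen [IsTopologicalGroup G] [CompactSpace G] (J : Subgroup G)
    (hJ : IsOpen (J : Set G)) : CompactSpace J :=
  isCompact_iff_compactSpace.mp (J.isClosed_of_isOpen hJ).isCompact

/-- **`ε¹_l(Π) = sup_{J ⊆ Π open} δ¹_l(J)` in `freeProlRank` terms** for compact `Π`: the print-literal
`epsilonInv Π 1 l` of `AbsTopIThm26iii.lean` is the supremum over the open subgroups `J` of
`freeProlRank J l`. [cite: MochizukiAbsTopI2012, Thm 2.6 p.21] -/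
theorem epsilonInv_one_eq_iSup_freeProlRank [IsTopologicalGroup G] [CompactSpace G] (l : ℕ)
    [Fact l.Prime] :
    epsilonInv G 1 l = ⨆ (J : Subgroup G) (_ : IsOpen (J : Set G)), freeProlRank J l := by
  unfold epsilonInv
  refine iSup_congr fun J => iSup_congr fun hJ => ?_
  haveI : CompactSpace J := compactSpace_subgroup_of_isOpen J hJ
  exact deltaInv_one_eq_freeProlRank l

/-- `l ∈ θ¹(Π)` as soon as the open subgroups of the compact group `Π` have unbounded free pro-`l`
rank (then `ε¹_l(Π) = ∞ ≥ 2`). [cite: MochizukiAbsTopI2012, Thm 2.6 p.21] -/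
theorem mem_thetaSet_one_of_forall_exists [IsTopologicalGroup G] [CompactSpace G] (l : ℕ)
    [hl : Fact l.Prime]
    (h : ∀ n : ℕ, ∃ J : Subgroup G, IsOpen (J : Set G) ∧ (n : ℕ∞) ≤ freeProlRank J l) :
    l ∈ thetaSet G 1 := by
  refine ⟨hl.out, ?_⟩
  have htop : epsilonInv G 1 l = ⊤ := by
    rw [epsilonInv_one_eq_iSup_freeProlRank]
    refine ENat.eq_top_iff_forall_ge.mpr fun n => ?_
    obtain ⟨J, hJ, hn⟩ := h n
    exact hn.trans (le_iSup₂_of_le J hJ le_rfl)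
  have hle : ((3 - 1 : ℕ) : ℕ∞) ≤ epsilonInv G 1 l := by
    rw [htop]
    exact le_top
  exact hle

namespace FundamentalExtension

/-- **[AbsTopI] Thm 2.6 (ii), last clause: "`ε¹_p(Π) = ∞`; in particular, the cardinality of
`θ¹(Π)` is always `≥ 1`"** — kernel link between the two typings: for an extension with MLF base
data, the typed `E.Thm26ii B S` (whose last conjunct is "for every `n` some open `H ⊆ Π` has
`δ¹_p(H) ≥ n`" in `freeProlRank` terms) puts the residue characteristic `p` in the print-literal
`thetaSet Π 1` of `AbsTopIThm26iii.lean`. [cite: MochizukiAbsTopI2012, Thm 2.6 (ii) p.21] -/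
theorem residueChar_mem_thetaSet_one_of_thm26ii (E : FundamentalExtension.{u}) (B : E.MLFBase)
    (S : Set ℕ) (h : E.Thm26ii B S) : B.p ∈ thetaSet E.arith 1 :=
  mem_thetaSet_one_of_forall_exists (G := E.arith) B.p h.2.2.2.2.2

/-- Hence `θ¹(Π)` is nonempty ("cardinality `≥ 1`") under the typed Thm 2.6 (ii).
[cite: MochizukiAbsTopI2012, Thm 2.6 (ii) p.21] -/
theorem thetaSet_one_nonempty_of_thm26ii (E : FundamentalExtension.{u}) (B : E.MLFBase)
    (S : Set ℕ) (h : E.Thm26ii B S) : (thetaSet E.arith 1).Nonempty :=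
  ⟨B.p, residueChar_mem_thetaSet_one_of_thm26ii E B S h⟩

end FundamentalExtension

end Literature.AnabelianGeometry.AbsoluteAnabelian
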